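import Literature.NumberTheory.GaloisRepresentations.SteinbergArtinRep
import Literature.RepresentationTheory.Semisimple.SubrepresentationEquiv
import HarnessLib

/-!
# The standard basis `e_y - e_{x₀}` of the augmentation module of a finite `G`-set

Topic `Literature/NumberTheory/GaloisRepresentations` (`SteinbergArtinRep`: the permutation module
`X →₀ k` of a `G`-set `X`, its augmentation `ε` and the augmentation submodule `(k^X)⁰ = ker ε`).
For a base point `x₀ ∈ X` the vectors `f_y = e_y - e_{x₀}`, `y ≠ x₀`, form a basis of `(k^X)⁰`, and
the action of `g ∈ G` in this basis is the INTEGER matrix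
`C(g)_{y, y'} = [g y' = y] - [g x₀ = y]` (`g f_{y'} = e_{g y'} - e_{g x₀} = Σ_y C(g)_{y,y'} f_y`),
independent of the coefficient ring `k`:

* `permRep_single_sub_single_eq_sum` — the displayed identity in `X →₀ k`;
* `augStdEquiv k x₀ : ({y // y ≠ x₀} → k) ≃ₗ[k] augmentationSubmodule k X` — coordinates in the basis
  (`e ↦ Σ_y e_y f_y`, inverse `w ↦ (w y)_y`), and `augmentationRep_augStdMap` — it intertwines
  `e ↦ C(g) e` with `augmentationRep k G X g`; hence
  `isIrreducible_glStd_comp_of_coe_eq_reindex_augStdMatrix`: a matrix representation `σ : G → GL_n(κ)`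
  over a field whose matrices are the `C(g)` (reindexed along `X ∖ {x₀} ≃ Fin n`) is irreducible as soon
  as the augmentation representation over `κ` is.

Used for the residual representation of the `λ`-adic representation of a Picard curve
(`PicardCurveGaloisRep`): its reduction in a suitable basis is `g ↦ C(g) mod 3` on the four roots,
so its base change to any field `k' ⊇ 𝔽₃` is the (irreducible) augmentation representation over `k'`.
Everything is proved; the three definitions (`augStdMatrix`, `augStdMap`, `augStdEquiv`) are genuine.

## References
* J.-P. Serre, *Linear Representations of Finite Groups*, GTM 42 (1977), §2.3 Ex. 2.6 (a).
  [SerreLinearRepresentations1977]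
-/

noncomputable section

namespace Literature.NumberTheory.GaloisRepresentations

open Finsupp Matrix

variable (k : Type*) [CommRing k] {G : Type*} [Group G] {X : Type*} [Fintype X] [DecidableEq X] [MulAction G X]
  (x₀ : X)

/-- **The integer matrix of `g` in the basis `f_y = e_y - e_{x₀}`** of the augmentation module:
`C(g)_{y,y'} = [g y' = y] - [g x₀ = y]` (with coefficients in `k`). [folklore] -/
def augStdMatrix (g : G) : Matrix {y : X // y ≠ x₀} {y : X // y ≠ x₀} k :=
  Matrix.of fun y y' => (if g • (y' : X) = y then 1 else 0) - (if g • x₀ = y then 1 else 0)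

omit [Fintype X] in
/-- Entries of `augStdMatrix`. [folklore] -/
theorem augStdMatrix_apply (g : G) (y y' : {y : X // y ≠ x₀}) :
    augStdMatrix k x₀ g y y' = (if g • (y' : X) = y then 1 else 0) - (if g • x₀ = y then 1 else 0) :=
  rfl

omit [Fintype X] in
/-- `augStdMatrix` over `k` is the image of `augStdMatrix` over `ℤ`. [folklore] -/
theorem augStdMatrix_map_intCast (g : G) :
    (augStdMatrix ℤ x₀ g).map (Int.cast : ℤ → k) = augStdMatrix k x₀ g := by
  ext y y'
  simp only [map_apply, augStdMatrix_apply, Int.cast_sub, Int.cast_ite, Int.cast_one, Int.cast_zero]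

omit [Fintype X] in
/-- `augStdMatrix` is compatible with ring homomorphisms. [folklore] -/
theorem augStdMatrix_map {k' : Type*} [CommRing k'] (φ : k →+* k') (g : G) :
    (augStdMatrix k x₀ g).map φ = augStdMatrix k' x₀ g := by
  ext y y'
  simp only [map_apply, augStdMatrix_apply, map_sub, apply_ite φ, map_one, map_zero]

/-- **`g (e_{y'} - e_{x₀}) = Σ_{y ≠ x₀} C(g)_{y,y'} (e_y - e_{x₀})`** in the permutation module.
[cite: SerreLinearRepresentations1977, §2.3 Ex. 2.6 (a)] -/
theorem permRep_single_sub_single_eq_sum (g : G) (y' : X) :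
    permRep k G X g (single y' 1 - single x₀ 1) =
      ∑ y : {y : X // y ≠ x₀}, ((if g • y' = y then (1 : k) else 0) - (if g • x₀ = y then 1 else 0)) •
        (single (y : X) 1 - single x₀ 1) := by
  -- the sum over all of `X` of `a z • (e_z - e_{x₀})`, `a z = [g y' = z] - [g x₀ = z]`
  set a : X → k := fun z => (if g • y' = z then (1 : k) else 0) - (if g • x₀ = z then 1 else 0) with ha
  have hsum_a : ∑ z, a z = 0 := by
    simp only [ha, Finset.sum_sub_distrib, Finset.sum_ite_eq, Finset.mem_univ, if_true, sub_self]
  have htotal : ∑ z : X, a z • (single z (1 : k) - single x₀ 1) = single (g • y') 1 - single (g • x₀) 1 := by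
    simp only [smul_sub, Finset.sum_sub_distrib, ← Finset.sum_smul, hsum_a, zero_smul, sub_zero]
    simp only [ha, sub_smul, Finset.sum_sub_distrib, ite_smul, one_smul, zero_smul, Finset.sum_ite_eq,
      Finset.mem_univ, if_true]
  rw [map_sub, permRep_single, permRep_single, ← htotal]
  -- drop the vanishing term `z = x₀`
  change _ = ∑ y : {y : X // y ≠ x₀}, a y • (single (y : X) (1 : k) - single x₀ 1)
  rw [← Finset.sum_subtype (p := fun z : X => z ≠ x₀) (Finset.univ.filter fun z : X => z ≠ x₀) (fun z => by simp)
    (fun z => a z • (Finsupp.single z (1 : k) - Finsupp.single x₀ 1)),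
    ← Finset.sum_filter_add_sum_filter_not Finset.univ (fun z : X => z ≠ x₀), add_eq_left]
  refine Finset.sum_eq_zero fun z hz => ?_
  rw [Finset.mem_filter, not_not] at hz
  rw [hz.2, sub_self, smul_zero]

omit [Fintype X] [DecidableEq X] in
/-- The vector `e_y - e_{x₀}` lies in the augmentation submodule. [folklore] -/
theorem single_sub_single_mem_augmentationSubmodule (y : X) :
    single y (1 : k) - single x₀ 1 ∈ augmentationSubmodule k X := by
  rw [mem_augmentationSubmodule_iff, map_sub, augmentation_single, augmentation_single, sub_self]

/-- The linear map `e ↦ Σ_{y ≠ x₀} e_y (e_y - e_{x₀})` into the augmentation submodule. [folklore] -/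
def augStdMap : ({y : X // y ≠ x₀} → k) →ₗ[k] augmentationSubmodule k X :=
  Fintype.linearCombination k fun y : {y : X // y ≠ x₀} =>
    (⟨single (y : X) 1 - single x₀ 1, single_sub_single_mem_augmentationSubmodule k x₀ y⟩ : augmentationSubmodule k X)

/-- The underlying vector of `augStdMap e`. [folklore] -/
theorem coe_augStdMap (e : {y : X // y ≠ x₀} → k) :
    ((augStdMap k x₀ e : augmentationSubmodule k X) : X →₀ k) =
      ∑ y : {y : X // y ≠ x₀}, e y • (single (y : X) 1 - single x₀ 1) := by
  rw [augStdMap, Fintype.linearCombination_apply, Submodule.coe_sum]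
  rfl

/-- Coordinates of `augStdMap e` away from the base point: `(Σ e_y f_y)(z) = e_z`. [folklore] -/
theorem augStdMap_apply_of_ne (e : {y : X // y ≠ x₀} → k) {z : X} (hz : z ≠ x₀) :
    ((augStdMap k x₀ e : augmentationSubmodule k X) : X →₀ k) z = e ⟨z, hz⟩ := by
  rw [coe_augStdMap, Finsupp.finsetSum_apply, Finset.sum_eq_single ⟨z, hz⟩]
  · simp [hz.symm]
  · intro y _ hy
    have hyz : (y : X) ≠ z := fun h => hy (Subtype.ext h)
    simp [hyz, hz.symm]
  · intro h
    exact absurd (Finset.mem_univ _) h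

/-- The coordinate of `augStdMap e` at the base point: `(Σ e_y f_y)(x₀) = -Σ e_y`. [folklore] -/
theorem augStdMap_apply_base (e : {y : X // y ≠ x₀} → k) :
    ((augStdMap k x₀ e : augmentationSubmodule k X) : X →₀ k) x₀ = -∑ y, e y := by
  rw [coe_augStdMap, Finsupp.finsetSum_apply, ← Finset.sum_neg_distrib]
  refine Finset.sum_congr rfl fun y _ => ?_
  have hy : (y : X) ≠ x₀ := y.2
  simp [hy]

/-- `augStdMap` is injective. [folklore] -/
theorem augStdMap_injective : Function.Injective (augStdMap k x₀) := by
  intro e e' h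
  funext ⟨z, hz⟩
  have h' := congrArg (fun w : augmentationSubmodule k X => (w : X →₀ k) z) h
  simpa only [augStdMap_apply_of_ne k x₀ _ hz] using h'

/-- `augStdMap` is surjective: `w = Σ_{y ≠ x₀} w(y) f_y` for `w` of augmentation `0`. [folklore] -/
theorem augStdMap_surjective : Function.Surjective (augStdMap k x₀) := by
  intro w
  refine ⟨fun y => (w : X →₀ k) y, Subtype.ext (Finsupp.ext fun z => ?_)⟩
  by_cases hz : z = x₀
  · subst hz
    rw [augStdMap_apply_base]
    have hw : ∑ x, (w : X →₀ k) x = 0 := by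
      have h := (mem_augmentationSubmodule_iff k (w : X →₀ k)).1 w.2
      rw [augmentation, Finsupp.linearCombination_apply] at h
      rw [← h, Finsupp.sum_fintype]
      · simp
      · intro; simp
    rw [← Finset.add_sum_erase _ _ (Finset.mem_univ z)] at hw
    rw [← Finset.sum_subtype (p := fun x : X => x ≠ z) (Finset.univ.erase z) (fun x => by simp) (fun x => (w : X →₀ k) x)]
    linear_combination (-1 : k) * hw
  · rw [augStdMap_apply_of_ne k x₀ _ hz]

/-- **The standard basis of the augmentation module**: `e ↦ Σ_{y ≠ x₀} e_y (e_y - e_{x₀})` is a linear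
isomorphism `k^{X ∖ {x₀}} ≅ (k^X)⁰`. [cite: SerreLinearRepresentations1977, §2.3 Ex. 2.6 (a)] -/
def augStdEquiv : ({y : X // y ≠ x₀} → k) ≃ₗ[k] augmentationSubmodule k X :=
  LinearEquiv.ofBijective (augStdMap k x₀) ⟨augStdMap_injective k x₀, augStdMap_surjective k x₀⟩

/-- `augStdEquiv e = augStdMap e`. [folklore] -/
@[simp]
theorem augStdEquiv_apply (e : {y : X // y ≠ x₀} → k) : augStdEquiv k x₀ e = augStdMap k x₀ e :=
  rfl

/-- **Equivariance**: `g · (Σ e_y f_y) = Σ (C(g) e)_y f_y`. [cite: SerreLinearRepresentations1977, §2.3 Ex. 2.6 (a)] -/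
theorem augmentationRep_augStdMap (g : G) (e : {y : X // y ≠ x₀} → k) :
    augmentationRep k G X g (augStdMap k x₀ e) = augStdMap k x₀ (augStdMatrix k x₀ g *ᵥ e) := by
  apply Subtype.ext
  rw [coe_augmentationRep_apply, coe_augStdMap, coe_augStdMap, map_sum]
  simp only [map_smul, permRep_single_sub_single_eq_sum, Finset.smul_sum, smul_smul, Matrix.mulVec, dotProduct,
    augStdMatrix_apply, Finset.sum_smul]
  rw [Finset.sum_comm]
  refine Finset.sum_congr rfl fun y _ => Finset.sum_congr rfl fun y' _ => ?_
  rw [mul_comm]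

/-- **The matrix representation `g ↦ C(g)` over a field is equivalent to the augmentation
representation**: if `σ : G → GL_n(κ)` has matrices `C(g)` (reindexed along `X ∖ {x₀} ≃ Fin n`), the
standard representation of `κⁿ` through `σ` is equivalent to `augmentationRep κ G X`, hence irreducible
when the latter is. [cite: SerreLinearRepresentations1977, §2.3 Ex. 2.6 (a)] -/
theorem isIrreducible_glStd_comp_of_coe_eq_reindex_augStdMatrix {κ : Type*} [Field κ] {n : ℕ}
    (eqv : {y : X // y ≠ x₀} ≃ Fin n) (σ : G →* GL (Fin n) κ)
    (hσ : ∀ g, ((σ g : GL (Fin n) κ) : Matrix (Fin n) (Fin n) κ) = Matrix.reindex eqv eqv (augStdMatrix κ x₀ g))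
    (hirr : Representation.IsIrreducible (k := κ) (G := G) (V := augmentationSubmodule κ X) (augmentationRep κ G X)) :
    Representation.IsIrreducible (k := κ) (G := G) (V := Fin n → κ) ((glStdRepresentation (Fin n) κ).comp σ) := by
  haveI := hirr
  -- the equivalence `(κ^X)⁰ ≃ κ^{X∖x₀} ≃ κⁿ`
  let Φ : augmentationSubmodule κ X ≃ₗ[κ] (Fin n → κ) :=
    (augStdEquiv κ x₀).symm ≪≫ₗ LinearEquiv.funCongrLeft κ κ eqv.symm
  refine Literature.RepresentationTheory.Semisimple.Representation.isIrreducible_of_equiv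
    (V := augmentationSubmodule κ X) (W := Fin n → κ) (ρ := augmentationRep κ G X)
    (σ := (glStdRepresentation (Fin n) κ).comp σ)
    (Representation.Equiv.mk (ρ := augmentationRep κ G X) (σ := (glStdRepresentation (Fin n) κ).comp σ) Φ
      fun g => LinearMap.ext fun w => ?_)
  obtain ⟨e, rfl⟩ := augStdMap_surjective κ x₀ w
  change Φ (augmentationRep κ G X g (augStdMap κ x₀ e)) = ((glStdRepresentation (Fin n) κ).comp σ) g (Φ (augStdMap κ x₀ e))
  rw [augmentationRep_augStdMap]
  have hΦ : ∀ e' : {y : X // y ≠ x₀} → κ, Φ (augStdMap κ x₀ e') = fun i => e' (eqv.symm i) := by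
    intro e'
    change LinearEquiv.funCongrLeft κ κ eqv.symm ((augStdEquiv κ x₀).symm (augStdEquiv κ x₀ e')) = _
    rw [LinearEquiv.symm_apply_apply]
    rfl
  rw [hΦ, hΦ, MonoidHom.coe_comp, Function.comp_apply, glStdRepresentation_apply, hσ, Matrix.reindex_apply,
    Matrix.submatrix_mulVec_equiv]
  have he : ((fun i => e (eqv.symm i)) ∘ ⇑eqv.symm.symm) = e := by
    funext y; simp
  rw [he]
  rfl

end Literature.NumberTheory.GaloisRepresentations

end
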